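/-
Copyright (c) 2026 the pub-hodgecm-mathlib formalisation cell (harness21).  Prover seat hodgecm-mathlib-B-p14 (g36): road «S3-tree» (LEAD F0P3a-plan (g11), architect A-p16 (g29)),
brick T1e «VALENCIES OF THE `U(3)` LATTICE TREE», FILE V2a = THE STAR OF THE ROOT IS ONE `K₀`-ORBIT; 2026-09-01.  Sequel of ★ `UnitaryLatticeTreeStar` (V1).
-/
import Literature.NumberTheory.Automorphic.UnitaryLatticeTreeStar   -- ★ T1e V1 (B-p14 (g36)): stars by type, `mem_neighborSet_root_iff`; brings the T1 cone (`HyperspecialUnitaryRootStarTransitive`, `…TypeTwoNormalForm`, …)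
import HarnessLib

/-!
# The lattice graph of a hermitian space — T1e FILE V2a: THE STAR OF THE ROOT `L₀ = 𝒪³` OF THE `U(3)` TREE IS THE `K₀`-ORBIT OF `N₁ = latt diag(1,1,ϖ)`, and each of its
# vertices is the residual hyperplane `{y ∈ 𝒪³ | B₀ x y ∈ 𝔪}` of a primitive isotropic `x` (Bruhat–Tits 1972 (4.4.4), §10; Tits 1979 §3.5; Serre, *Trees* II.1.1)

Topic `NumberTheory/Automorphic`; namespace `Literature.NumberTheory.Automorphic.UnitaryLatticeTree`.  THEOREMS ONLY (no definition, no instance, no notation, no named fact,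
no `sorry`); kernel lane.  Cell `pub/hodgecm-mathlib` (D-0151), crux H413 = `stmt-HodgeConjecture-24833`; road «S3-tree», brick **T1e «VALENCIES»** (the `(q³+1, q+1)` numbers read
by the T2-S fold through ★ `TreeDisplacementLayerCount` ED. 2), FILE V2a: the residue-field-free half of the count of the star of a SELF-DUAL vertex.  FILE V2b counts.

THE MATHEMATICS (`K` with `Valued K ℤᵐ⁰`, `hd : UnramifiedLocalConjDatum σ ϖ`, `J₀ = antidiag(1,1,1)` with pairing `B₀ σ 3`, `L₀ = 𝒪³ = stdLattice K 3`, `N₁ = latt diag(1,1,ϖ) =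
{y ∈ 𝒪³ | y₂ ∈ 𝔪}`, `K₀ = unitaryInt σ J₀ = U(J₀) ∩ GL₃(𝒪)`).  By ★ V1 the star of `L₀` is the set of (type-two) vertices `M < L₀`.
(§1) For `κ ∈ K₀`: `y ∈ κ·N₁ ↔ y ∈ 𝒪³ ∧ (κ⁻¹y)₂ ∈ 𝔪`, and `κ·N₁ < L₀` (a type-two vertex is not self-dual).
(§2) EXHAUSTION — every type-two vertex `M < L₀` is `κ·N₁` for some `κ ∈ K₀` (the DUAL TRICK): `L₀ = L₀^♯ < M^♯` (★ `dualLatt_dualLatt_latt`), pick `w ∈ M^♯ ∖ L₀` and put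
`x := ϖw`; then `x ∈ ϖM^♯ ⊆ M ⊆ L₀`, `x` is PRIMITIVE (a coordinate of `w` outside `𝒪` becomes a unit: `|x_j| < 1` would force `|w_j| ≤ 1`), RESIDUALLY ISOTROPIC
(`B₀ x x = ϖ·(ϖ B₀ w w)` and `|ϖ B₀ w w| = |B₀ (ϖw) w| ≤ 1` as `ϖw ∈ M`, `w ∈ M^♯`), and `M ⊆ N_x := {y ∈ 𝒪³ | B₀ x y ∈ 𝔪}` (`B₀ x y = ϖ·B₀ w y`, `|B₀ w y| = |B₀ y w| ≤ 1`);
ROOT-STAR TRANSITIVITY ★ `exists_mem_unitaryInt_rootStar_eq` (B-p14 (g35), with the trace element of `hd`) gives `N_x = κ·N₁`, `κ ∈ K₀`, a type-two vertex, and (D2)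
★ `eq_of_le_of_isVertexLattice` forces `M = κ·N₁`.  Hence (§3) **`star(L₀) = {κ·N₁ | κ ∈ K₀}`**, and (§4) every vertex of the star is a residual hyperplane `N_x` with `x` primitive,
integral and EXACTLY isotropic (`x = κe₀`, ★ `firstColumn_props`), while conversely every primitive residually-isotropic `x ∈ 𝒪³` cuts out a vertex `N_x` of the star — the two
halves of the bijection «star of `L₀` ↔ isotropic points of `(𝓀³, B̄₀)`» that FILE V2b counts (`q³ + 1`).

* §1 **`mem_mapGL_N₁_iff_of_mem_unitaryInt`**, `mapGL_N₁_lt_stdLattice`.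
* §2 **`exists_mem_unitaryInt_eq_mapGL_N₁_of_lt`** (exhaustion).
* §3 **`mem_neighborSet_root_iff_exists_mem_unitaryInt`** (`star(L₀) = K₀·N₁`).
* §4 **`exists_mem_neighborSet_root_forall_mem_iff`** (every residually isotropic primitive `x` gives a vertex `N_x` of the star), **`exists_isotropic_forall_mem_iff_of_mem_neighborSet_root`**
  (every vertex of the star is an `N_x`, `x` primitive exactly isotropic), `eq_of_forall_mem_iff` (a vertex is determined by its members).

HONEST LABEL: HC_CM is proved only modulo the 2 remaining named inputs (hLiu418 24832, h413 24833) until rung 0 closes; nothing printed is asserted here (elementary lattice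
algebra over a valuation ring); S3 (`stub_N6nsS3id`) stays a print row until the road's END lands.

## References
* [BruhatTits1972] F. Bruhat, J. Tits, *Groupes réductifs sur un corps local I*, Publ. Math. IHÉS 41 (1972), (4.4.4) (`K₀` transitive on the chambers at its vertex), §10.
* [Tits1979] J. Tits, *Reductive groups over local fields*, PSPM 33.1 (1979), §3.5 (the star of a vertex is the residual spherical building).
* [Serre1980Trees] J.-P. Serre, *Trees* (1980), Ch. II §1.1 (neighbours of a lattice = lines of its reduction).
* [Jacobowitz1962] R. Jacobowitz, *Hermitian forms over local fields*, Amer. J. Math. 84 (1962), §4 (dual lattices), §7–§8.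
-/

set_option autoImplicit false

noncomputable section

open scoped Valued WithZero Matrix MatrixGroups

namespace Literature.NumberTheory.Automorphic.UnitaryLatticeTree

open Literature.NumberTheory.Automorphic Literature.NumberTheory.Automorphic.HermitianLattice
open Literature.NumberTheory.Automorphic.CartanUnique

variable {K : Type*} [Field K] [Valued K ℤᵐ⁰] {σ : K →+* K} {ϖ : K}

/-! ## §1 Membership in `κ·N₁` and `κ·N₁ < L₀` for `κ ∈ K₀` -/

/-- **`y ∈ κ·N₁ ↔ y ∈ 𝒪³ ∧ (κ⁻¹y)₂ ∈ 𝔪`** for `κ ∈ K₀` (`N₁ = latt diag(1,1,ϖ) = {z ∈ 𝒪³ | z₂ ∈ 𝔪}`, `κ·𝒪³ = 𝒪³`). [cite: Serre1980Trees, II.1.1] [cite: Tits1979, §3.5] -/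
theorem mem_mapGL_N₁_iff_of_mem_unitaryInt (hϖ : Valued.v ϖ = WithZero.exp (-1 : ℤ))
    {κ : unitaryGroupOfForm σ ((StdForm.antidiagonal 3).over K)} (hκ : κ ∈ unitaryInt σ ((StdForm.antidiagonal 3).over K)) (y : Fin 3 → K) :
    y ∈ mapGL (κ : GL (Fin 3) K) (latt (Matrix.diagonal ![(1 : K), 1, ϖ])) ↔
      y ∈ stdLattice K 3 ∧
        Valued.v ((((κ⁻¹ : unitaryGroupOfForm σ ((StdForm.antidiagonal 3).over K)) : GL (Fin 3) K) : Matrix (Fin 3) (Fin 3) K).mulVec y 2) < 1 := by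
  have hϖ0 : ϖ ≠ 0 := uniformizer_ne_zero hϖ
  have hϖ1 : Valued.v ϖ ≤ 1 := uniformizer_mem_integer hϖ
  have hlt : ∀ z : K, Valued.v z < 1 ↔ Valued.v z ≤ Valued.v ϖ := fun z => by rw [hϖ]; exact v_lt_one_iff z
  have hd' : ∀ i, (![(1 : K), 1, ϖ] : Fin 3 → K) i ≠ 0 := by intro i; fin_cases i <;> simp [hϖ0]
  constructor
  · intro hy
    have hyL : y ∈ stdLattice K 3 := (mapGL_N₁_le hκ hϖ1 hϖ0).2 hy
    refine ⟨hyL, ?_⟩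
    rw [mem_mapGL_iff, ← Subgroup.coe_inv, mem_latt_diagonal_iff hd'] at hy
    have h2 := hy 2
    simp only [Matrix.cons_val_two, Matrix.tail_cons, Matrix.head_cons] at h2
    exact (hlt _).2 h2
  · rintro ⟨hyL, h2⟩
    rw [mem_mapGL_iff, ← Subgroup.coe_inv, mem_latt_diagonal_iff hd']
    have hz := mulVec_mem_stdLattice_of_mem_unitaryInt_inv hκ hyL
    intro i
    fin_cases i
    · simpa using hz 0
    · simpa using hz 1
    · simpa using (hlt _).1 h2

/-- **`κ·N₁ < L₀` for `κ ∈ K₀`** (`κ·N₁ ≤ κ·𝒪³ = 𝒪³`, and a type-two vertex is not the self-dual `𝒪³`). [cite: BruhatTits1972, §10] [cite: Serre1980Trees, II.1.1] -/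
theorem mapGL_N₁_lt_stdLattice (hd : UnramifiedLocalConjDatum σ ϖ)
    {κ : unitaryGroupOfForm σ ((StdForm.antidiagonal 3).over K)} (hκ : κ ∈ unitaryInt σ ((StdForm.antidiagonal 3).over K)) :
    mapGL (κ : GL (Fin 3) K) (latt (Matrix.diagonal ![(1 : K), 1, ϖ])) < stdLattice K 3 := by
  have hϖ0 : ϖ ≠ 0 := uniformizer_ne_zero hd.vϖ
  have hϖ1 : Valued.v ϖ ≤ 1 := uniformizer_mem_integer hd.vϖ
  refine lt_of_le_of_ne (mapGL_N₁_le hκ hϖ1 hϖ0).2 fun hEq => ?_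
  have h2 : IsVertexLattice σ ϖ ((StdForm.antidiagonal 3).over K) 2 (stdLattice K 3) := by
    rw [← hEq]
    exact isVertexLattice_mapGL σ ϖ _ _ κ.2 (isVertexLattice_two_latt_diagonal_one_one hd.σϖ hϖ1 hϖ0)
  exact not_isSelfDualLattice_of_isVertexLattice_two hd h2 (isSelfDualLattice_stdLattice_three hd)

/-! ## §2 Exhaustion: every type-two vertex below the root is a `K₀`-translate of `N₁` -/

/-- **EXHAUSTION OF THE STAR OF THE ROOT**: a type-two vertex `M < L₀ = 𝒪³` is `κ·N₁` for some `κ ∈ K₀` — the dual trick (`x = ϖw`, `w ∈ M^♯ ∖ L₀`, is primitive, residually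
isotropic, and `M ⊆ N_x`) followed by root-star transitivity ★ `exists_mem_unitaryInt_rootStar_eq` and (D2). [cite: BruhatTits1972, (4.4.4) and §10] [cite: Serre1980Trees, II.1.1] [cite: Jacobowitz1962, §4] -/
theorem exists_mem_unitaryInt_eq_mapGL_N₁_of_lt (hd : UnramifiedLocalConjDatum σ ϖ) {M : Submodule 𝒪[K] (Fin 3 → K)}
    (hM : IsVertexLattice σ ϖ ((StdForm.antidiagonal 3).over K) 2 M) (hlt : M < stdLattice K 3) :
    ∃ κ : unitaryGroupOfForm σ ((StdForm.antidiagonal 3).over K), κ ∈ unitaryInt σ ((StdForm.antidiagonal 3).over K) ∧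
      M = mapGL (κ : GL (Fin 3) K) (latt (Matrix.diagonal ![(1 : K), 1, ϖ])) := by
  have hϖ0 : ϖ ≠ 0 := uniformizer_ne_zero hd.vϖ
  have hϖ1 : Valued.v ϖ ≤ 1 := uniformizer_mem_integer hd.vϖ
  have hvϖ1 : Valued.v ϖ < 1 := by rw [hd.vϖ, ← WithZero.exp_zero]; exact WithZero.exp_lt_exp.2 (by norm_num)
  have hlt1 : ∀ z : K, Valued.v z < 1 ↔ Valued.v z ≤ Valued.v ϖ := fun z => by rw [hd.vϖ]; exact v_lt_one_iff z
  have hH : IsUnit ((StdForm.antidiagonal 3).over K).det := isUnit_det_antidiagonal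
  have hL₀ : dualLatt σ ((StdForm.antidiagonal 3).over K) (stdLattice K 3) = stdLattice K 3 :=
    dualLatt_stdLattice_eq_self σ hd.vσ hH isIntMatrix_antidiagonal isIntMatrix_antidiagonal_inv
  have hL₀le : stdLattice K 3 ≤ dualLatt σ ((StdForm.antidiagonal 3).over K) M := by
    conv_lhs => rw [← hL₀]
    exact dualLatt_antitone σ _ hlt.le
  -- `M^♯` is NOT contained in `L₀`: else `M^♯ = L₀` and `M = M^♯♯ = L₀^♯ = L₀`
  have hne : ¬ dualLatt σ ((StdForm.antidiagonal 3).over K) M ≤ stdLattice K 3 := by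
    intro hle
    have hEq : dualLatt σ ((StdForm.antidiagonal 3).over K) M = stdLattice K 3 := le_antisymm hle hL₀le
    obtain ⟨g, hg, -, -, -⟩ := hM
    have hHh : (((StdForm.antidiagonal 3).over K).map σ)ᵀ = (StdForm.antidiagonal 3).over K := by rw [StdForm.over_map, StdForm.transpose_over]
    have hMM : dualLatt σ ((StdForm.antidiagonal 3).over K) (dualLatt σ ((StdForm.antidiagonal 3).over K) M) = M := by
      rw [hg]; exact dualLatt_dualLatt_latt σ hd.σσ hd.vσ hH hHh (Matrix.isUnits_det_units g)
    exact hlt.ne (by rw [← hMM, hEq, hL₀])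
  obtain ⟨w, hwd, hwL⟩ := SetLike.not_le_iff_exists.1 hne
  -- `x := ϖ • w ∈ M ⊆ L₀`
  have hxM : ϖ • w ∈ M := by
    refine scaleLattice_dualLatt_le_of_isVertexLattice hd.vσ hH hM ((mem_scaleLattice_iff hϖ0 _ _).2 ?_)
    rwa [inv_smul_smul₀ hϖ0]
  have hx : ϖ • w ∈ stdLattice K 3 := hlt.le hxM
  -- `x` is primitive
  have hunit : ∃ j, Valued.v ((ϖ • w) j) = 1 := by
    obtain ⟨j, hj⟩ : ∃ j, ¬ Valued.v (w j) ≤ 1 := by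
      by_contra h
      push Not at h
      exact hwL h
    refine ⟨j, le_antisymm (hx j) (not_lt.1 fun hlt' => hj ?_)⟩
    have hle : Valued.v ((ϖ • w) j) ≤ Valued.v ϖ := (hlt1 _).1 hlt'
    rw [Pi.smul_apply, smul_eq_mul, map_mul] at hle
    calc Valued.v (w j) = Valued.v ϖ⁻¹ * (Valued.v ϖ * Valued.v (w j)) := by
          rw [← mul_assoc, ← map_mul, inv_mul_cancel₀ hϖ0, map_one, one_mul]
      _ ≤ Valued.v ϖ⁻¹ * Valued.v ϖ := mul_le_mul_right hle _
      _ = 1 := by rw [← map_mul, inv_mul_cancel₀ hϖ0, map_one]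
  -- `|B₀ w y| ≤ 1` for `y ∈ M` (`w ∈ M^♯`, hermitian symmetry)
  have hwy : ∀ y ∈ M, Valued.v (B₀ σ 3 w y) ≤ 1 := by
    intro y hy
    have h := (mem_dualLatt σ _ M w).1 hwd y hy
    rw [pairing_antidiagonal] at h
    rw [← isHermitianForm_B₀ hd.σσ y w, hd.vσ]
    exact h
  -- `x` is residually isotropic
  have hiso : Valued.v (B₀ σ 3 (ϖ • w) (ϖ • w)) < 1 := by
    rw [LinearMap.map_smulₛₗ₂, smul_eq_mul, map_mul, hd.vσ]
    calc Valued.v ϖ * Valued.v (B₀ σ 3 w (ϖ • w)) ≤ Valued.v ϖ * 1 := mul_le_mul_right (hwy _ hxM) _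
      _ < 1 := by rw [mul_one]; exact hvϖ1
  -- root-star transitivity: `N_x = κ·N₁`
  obtain ⟨τ, hτ, hτσ⟩ := hd.trace
  obtain ⟨κ, hκ, hiff⟩ := exists_mem_unitaryInt_rootStar_eq hd.σσ hd.vσ hτ hτσ hx hunit hiso (i₀ := 0) (by decide)
  have r0 : Fin.rev (0 : Fin 3) = 2 := by decide
  simp only [r0] at hiff
  refine ⟨κ, hκ, eq_of_le_of_isVertexLattice hd.vσ hϖ0 hM
    (isVertexLattice_mapGL σ ϖ _ _ κ.2 (isVertexLattice_two_latt_diagonal_one_one hd.σϖ hϖ1 hϖ0)) fun y hy => ?_⟩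
  -- `M ⊆ N_x = κ·N₁`
  have hyL : y ∈ stdLattice K 3 := hlt.le hy
  refine (mem_mapGL_N₁_iff_of_mem_unitaryInt hd.vϖ hκ y).2 ⟨hyL, (hiff y hyL).1 ?_⟩
  rw [LinearMap.map_smulₛₗ₂, smul_eq_mul, map_mul, hd.vσ]
  calc Valued.v ϖ * Valued.v (B₀ σ 3 w y) ≤ Valued.v ϖ * 1 := mul_le_mul_right (hwy y hy) _
    _ < 1 := by rw [mul_one]; exact hvϖ1

/-! ## §3 The star of the root is the `K₀`-orbit of `N₁` -/

/-- **`star(L₀) = {κ·N₁ | κ ∈ K₀}`**: a vertex is adjacent to the root `𝒪³` iff it is a `K₀`-translate of the standard type-two neighbour `N₁ = latt diag(1,1,ϖ)`.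
[cite: BruhatTits1972, (4.4.4) and §10] [cite: Tits1979, §3.5] [cite: Serre1980Trees, II.1.1] -/
theorem mem_neighborSet_root_iff_exists_mem_unitaryInt (hd : UnramifiedLocalConjDatum σ ϖ)
    (w : {M : Submodule 𝒪[K] (Fin 3 → K) // IsVertex σ ϖ ((StdForm.antidiagonal 3).over K) M}) :
    w ∈ (latticeGraph σ ϖ ((StdForm.antidiagonal 3).over K)).neighborSet ⟨stdLattice K 3, 0, isSelfDualLattice_stdLattice_three hd⟩ ↔
      ∃ κ : unitaryGroupOfForm σ ((StdForm.antidiagonal 3).over K), κ ∈ unitaryInt σ ((StdForm.antidiagonal 3).over K) ∧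
        w.1 = mapGL (κ : GL (Fin 3) K) (latt (Matrix.diagonal ![(1 : K), 1, ϖ])) := by
  rw [mem_neighborSet_root_iff hd]
  constructor
  · intro hlt
    have h2 : IsVertexLattice σ ϖ ((StdForm.antidiagonal 3).over K) 2 w.1 :=
      (isVertexLattice_two_and_isSelfDualLattice_of_lt hd w.2 ⟨0, isSelfDualLattice_stdLattice_three hd⟩ hlt).1
    exact exists_mem_unitaryInt_eq_mapGL_N₁_of_lt hd h2 hlt
  · rintro ⟨κ, hκ, hw⟩
    rw [hw]
    exact mapGL_N₁_lt_stdLattice hd hκ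

/-! ## §4 The vertices of the star as residual hyperplanes `N_x = {y ∈ 𝒪³ | B₀ x y ∈ 𝔪}` -/

/-- A vertex is determined by the members of its lattice. [cite: Serre1980Trees, II.1.1] -/
theorem eq_of_forall_mem_iff {N : ℕ} {H : Matrix (Fin N) (Fin N) K} {v w : {M : Submodule 𝒪[K] (Fin N → K) // IsVertex σ ϖ H M}}
    (h : ∀ y, y ∈ v.1 ↔ y ∈ w.1) : v = w :=
  Subtype.ext (SetLike.ext h)

/-- **Every primitive residually isotropic `x ∈ 𝒪³` cuts out a vertex of the star of the root**: there is `w ∈ star(L₀)` whose lattice is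
`N_x = {y ∈ 𝒪³ | B₀ x y ∈ 𝔪}` (namely `κ·N₁` for the `κ ∈ K₀` of ★ `exists_mem_unitaryInt_rootStar_eq`). [cite: BruhatTits1972, (4.4.4) and §10] [cite: Serre1980Trees, II.1.1] -/
theorem exists_mem_neighborSet_root_forall_mem_iff (hd : UnramifiedLocalConjDatum σ ϖ) {x : Fin 3 → K} (hx : x ∈ stdLattice K 3)
    (hunit : ∃ j, Valued.v (x j) = 1) (hiso : Valued.v (B₀ σ 3 x x) < 1) :
    ∃ w ∈ (latticeGraph σ ϖ ((StdForm.antidiagonal 3).over K)).neighborSet ⟨stdLattice K 3, 0, isSelfDualLattice_stdLattice_three hd⟩,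
      ∀ y, y ∈ w.1 ↔ y ∈ stdLattice K 3 ∧ Valued.v (B₀ σ 3 x y) < 1 := by
  have hϖ0 : ϖ ≠ 0 := uniformizer_ne_zero hd.vϖ
  have hϖ1 : Valued.v ϖ ≤ 1 := uniformizer_mem_integer hd.vϖ
  obtain ⟨τ, hτ, hτσ⟩ := hd.trace
  obtain ⟨κ, hκ, hiff⟩ := exists_mem_unitaryInt_rootStar_eq hd.σσ hd.vσ hτ hτσ hx hunit hiso (i₀ := 0) (by decide)
  have r0 : Fin.rev (0 : Fin 3) = 2 := by decide
  simp only [r0] at hiff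
  refine ⟨⟨mapGL (κ : GL (Fin 3) K) (latt (Matrix.diagonal ![(1 : K), 1, ϖ])), 2,
    isVertexLattice_mapGL σ ϖ _ _ κ.2 (isVertexLattice_two_latt_diagonal_one_one hd.σϖ hϖ1 hϖ0)⟩,
    (mem_neighborSet_root_iff_exists_mem_unitaryInt hd _).2 ⟨κ, hκ, rfl⟩, fun y => ?_⟩
  rw [mem_mapGL_N₁_iff_of_mem_unitaryInt hd.vϖ hκ y]
  constructor
  · rintro ⟨hyL, h2⟩; exact ⟨hyL, (hiff y hyL).2 h2⟩
  · rintro ⟨hyL, hB⟩; exact ⟨hyL, (hiff y hyL).1 hB⟩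

/-- **Every vertex of the star of the root is a residual hyperplane `N_x`** with `x ∈ 𝒪³` primitive and EXACTLY isotropic (`x = κe₀` for the `κ ∈ K₀` of §3, ★ `firstColumn_props`,
★ `mem_mapGL_N₁_iff`). [cite: BruhatTits1972, §10] [cite: Tits1979, §3.5] [cite: Serre1980Trees, II.1.1] -/
theorem exists_isotropic_forall_mem_iff_of_mem_neighborSet_root (hd : UnramifiedLocalConjDatum σ ϖ)
    {w : {M : Submodule 𝒪[K] (Fin 3 → K) // IsVertex σ ϖ ((StdForm.antidiagonal 3).over K) M}}
    (hw : w ∈ (latticeGraph σ ϖ ((StdForm.antidiagonal 3).over K)).neighborSet ⟨stdLattice K 3, 0, isSelfDualLattice_stdLattice_three hd⟩) :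
    ∃ x : Fin 3 → K, x ∈ stdLattice K 3 ∧ (∃ j, Valued.v (x j) = 1) ∧ B₀ σ 3 x x = 0 ∧
      ∀ y, y ∈ w.1 ↔ y ∈ stdLattice K 3 ∧ Valued.v (B₀ σ 3 x y) < 1 := by
  have hϖ0 : ϖ ≠ 0 := uniformizer_ne_zero hd.vϖ
  have hϖ1 : Valued.v ϖ ≤ 1 := uniformizer_mem_integer hd.vϖ
  have hlt1 : ∀ z : K, Valued.v z < 1 ↔ Valued.v z ≤ Valued.v ϖ := fun z => by rw [hd.vϖ]; exact v_lt_one_iff z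
  obtain ⟨κ, hκ, hwκ⟩ := (mem_neighborSet_root_iff_exists_mem_unitaryInt hd w).1 hw
  obtain ⟨hxint, hxiso, hxunit⟩ := firstColumn_props (K := K) hκ
  refine ⟨_, hxint, hxunit, hxiso, fun y => ?_⟩
  rw [hwκ]
  constructor
  · intro hy
    have hyL : y ∈ stdLattice K 3 := (mapGL_N₁_le hκ hϖ1 hϖ0).2 hy
    exact ⟨hyL, (hlt1 _).2 ((mem_mapGL_N₁_iff hκ hϖ0 hyL).1 hy)⟩
  · rintro ⟨hyL, hB⟩
    exact (mem_mapGL_N₁_iff hκ hϖ0 hyL).2 ((hlt1 _).1 hB)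

end Literature.NumberTheory.Automorphic.UnitaryLatticeTree

end
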